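import Mathlib.Tactic.Module
import Mathlib.Analysis.Calculus.Deriv.Mul
import Mathlib.Analysis.Calculus.Deriv.Pow
import Literature.MathematicalPhysics.QuantumFieldTheory.Balaban1983to89.MatrixNorms
import HarnessLib

/-!
# Route `UnitScaleTilt`, crux K1 child «MinimiserStabilityRegPr» (stmt-QuantumFields-19200), leaf V2′ `stub_halvingStep` — pillar P3b
# ([Balaban1985Variational] PROP. 4 AT BACKGROUND 1), PART 1b: **THE CUBIC TAYLOR TERM OF THE PLAQUETTE PRODUCT IN `M_n(ℂ)` — SLOT-ONE
# TRACE-GRADIENT, CYCLIC INVARIANCE, AND THE LEIBNIZ CANCELLATION IDENTITY** (matrix algebra only; no lattice)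

Cell `ym3-torus` (HUMAN RULING D-0037, YM ladder rung R3), width seat `ym-ust-19200-w5` gen 0 (OWNER ym3-torus-plan g24, W-SEAT MAP pass #2 2026-08-28:
«w5 = `stub_halvingStep` sub-lemma P3b = [Balaban1985Variational] Prop. 4 (98) pp. 292–293 at background 1 = the displayed `hWq`∕`hWd` of F4
`FlatSmallSolution158.existsUnique_smallSolution158_T3`»).  `--supports stmt-QuantumFields-19200 --as helper`; count-neutral.  Companion of
`UnitScaleTiltProp8FlatPlaqCubicExpansion` (the third-order expansion `e^{Y₁}e^{Y₂}e^{Y₃}e^{Y₄} = 1 + ΣYᵢ + Q(Y) + C(Y) + O(m⁴)`).  YM₃ on T³ is a ladder rung (R3),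
not the Clay problem; nothing here is a claim about the crux, d = 4 or the mass gap.

THE PRINT.  [Balaban1985Variational] Prop. 4 (pp. 292–293) bounds the functional derivative of the non-quadratic part of the charted action by
«C₄(max{|A′|₍₋₁₎, |∇A′|₍₋₂₎})²» (98); the delicate term is the cubic one, whose gradient at a bond `b` sums over the `2(d−1)` plaquettes containing `b` and is
only `O(|A′|²)` AFTER the cancellation between the two plaquettes of each plane through `b` ((93)–(96): «we can use the factor η to replace this derivative by a
simple difference operation … (95) can be estimated by O(1)|∇A′||A′| also»).  With the ordered cubic Taylor term
`C(Y) = ⅙ΣYᵢ³ + ½Σ_{i<j}(Yᵢ²Yⱼ + YᵢYⱼ²) + Σ_{i<j<k}YᵢYⱼY_k` of the companion file, THIS FILE proves: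
* `trace_quad_eq` — `tr(½ΣYᵢ² + Σ_{i<j}YᵢYⱼ) = ½tr((ΣYᵢ)²)` (the second-order term is the quadratic FORM of (26));
* `cubic_slot1_expand`, `hasDerivAt_cubicPoly_zero`, **`hasDerivAt_trace_cubic_slot1`** — `d/dt tr C(Y₁ + tH, Y₂, Y₃, Y₄)|₀ = tr(H·∇₁C(Y))` with the slot-one
  trace-gradient `∇₁C(Y) = ½Y₁² + ½Σ_{j>1}(Y₁Yⱼ + YⱼY₁ + Yⱼ²) + Y₂Y₃ + Y₂Y₄ + Y₃Y₄`;
* **`trace_cubic_rotate`** — `tr C(Y₂,Y₃,Y₄,Y₁) = tr C(Y₁,Y₂,Y₃,Y₄)` (so every slot-gradient of `tr C` is a slot-ONE gradient of a rotation);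
* **`two_smul_grad1_sub_grad1_rotate2`** — THE LEIBNIZ IDENTITY `2(∇₁C(Y₁,Y₂,Y₃,Y₄) − ∇₁C(Y₃,Y₄,Y₁,Y₂)) = 2[Y₂, S+T] + [S,T]`, `S = Y₁+Y₃`, `T = Y₂+Y₄`
  (on a lattice plaquette `S`, `T` are `±iη`·bond DIFFERENCES of the field, so the slot-one and slot-three gradients cancel to first order);
* `norm_grad1_sub_grad1_le` (Lipschitz, `16mΔ`), `norm_comm_combo_le`, and the assembled **`norm_grad1_sub_grad1_halfturn_le`**:
  `‖∇₁C(Y) − ∇₁C(Z₃,Z₄,Z₁,Z₂)‖ ≤ 16mΔ + 4mδ + δ²` for slotwise `‖Yᵢ − Zᵢ‖ ≤ Δ` and `‖Y₁+Y₃‖, ‖Y₂+Y₄‖ ≤ δ`.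
HONEST SCOPE.  Elementary ([folklore]) matrix identities and norm bounds in the `L²`-operator norm, cited to the printed step they serve; nothing of Bałaban's is
asserted.  Sorry-free, no definition, axioms standard.

References: T. Bałaban, CMP **102** (1985) 277–309 [Balaban1985Variational] (26) p.282, (34)–(36) p.283, Prop. 4 (90)–(98) pp.291–293.
-/

set_option autoImplicit false

noncomputable section

open scoped BigOperators

namespace Summit.QuantumFields.YangMills.Theorems.FlatPlaqCubic

/-! ## §3 The cubic Taylor term in `M_n(ℂ)`: slot-one trace-gradient, cyclic invariance, the Leibniz identity -/

section Cubic

open scoped Matrix.Norms.L2Operator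

variable {n : Type*} [Fintype n] [DecidableEq n]

/-- The quadratic ORDERED term has the trace of half a square: `tr(½ΣYᵢ² + Σ_{i<j}YᵢYⱼ) = ½ tr((ΣYᵢ)²)` (so in the action the second-order term is
the quadratic FORM of (26)). [cite: Balaban1985Variational, (26) p.282] -/
theorem trace_quad_eq (Y₁ Y₂ Y₃ Y₄ : Matrix n n ℂ) :
    Matrix.trace ((2 : ℂ)⁻¹ • (Y₁ ^ 2 + Y₂ ^ 2 + Y₃ ^ 2 + Y₄ ^ 2) + (Y₁ * Y₂ + Y₁ * Y₃ + Y₁ * Y₄ + Y₂ * Y₃ + Y₂ * Y₄ + Y₃ * Y₄)) =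
      (2 : ℂ)⁻¹ * Matrix.trace ((Y₁ + Y₂ + Y₃ + Y₄) ^ 2) := by
  have h12 : Matrix.trace (Y₂ * Y₁) = Matrix.trace (Y₁ * Y₂) := Matrix.trace_mul_comm _ _
  have h13 : Matrix.trace (Y₃ * Y₁) = Matrix.trace (Y₁ * Y₃) := Matrix.trace_mul_comm _ _
  have h14 : Matrix.trace (Y₄ * Y₁) = Matrix.trace (Y₁ * Y₄) := Matrix.trace_mul_comm _ _
  have h23 : Matrix.trace (Y₃ * Y₂) = Matrix.trace (Y₂ * Y₃) := Matrix.trace_mul_comm _ _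
  have h24 : Matrix.trace (Y₄ * Y₂) = Matrix.trace (Y₂ * Y₄) := Matrix.trace_mul_comm _ _
  have h34 : Matrix.trace (Y₄ * Y₃) = Matrix.trace (Y₃ * Y₄) := Matrix.trace_mul_comm _ _
  simp only [pow_two, add_mul, mul_add, Matrix.trace_add, Matrix.trace_smul, smul_eq_mul]
  linear_combination (-(2 : ℂ)⁻¹) * (h12 + h13 + h14 + h23 + h24 + h34)

/-- **The slot-one expansion of the cubic term is an exact cubic in the parameter**: `C(Y₁ + tH, Y₂, Y₃, Y₄) = C(Y) + t·D₁ + t²·D₂ + t³·D₃` with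
`D₁ = ⅙(HY₁Y₁ + Y₁HY₁ + Y₁Y₁H) + ½Σ_{j>1}(HY₁Yⱼ + Y₁HYⱼ + HYⱼYⱼ) + HY₂Y₃ + HY₂Y₄ + HY₃Y₄` (used for the derivative at `t = 0`). [folklore] -/
theorem cubic_slot1_expand (Y₁ Y₂ Y₃ Y₄ H : Matrix n n ℂ) (t : ℂ) :
    ((6 : ℂ)⁻¹ • ((Y₁ + t • H) ^ 3 + Y₂ ^ 3 + Y₃ ^ 3 + Y₄ ^ 3) + (2 : ℂ)⁻¹ • ((Y₁ + t • H) ^ 2 * Y₂ + (Y₁ + t • H) * Y₂ ^ 2 + (Y₁ + t • H) ^ 2 * Y₃ + (Y₁ + t • H) * Y₃ ^ 2 + (Y₁ + t • H) ^ 2 * Y₄ + (Y₁ + t • H) * Y₄ ^ 2 + Y₂ ^ 2 * Y₃ + Y₂ * Y₃ ^ 2 + Y₂ ^ 2 * Y₄ + Y₂ * Y₄ ^ 2 + Y₃ ^ 2 * Y₄ + Y₃ * Y₄ ^ 2) + ((Y₁ + t • H) * Y₂ * Y₃ + (Y₁ + t • H) * Y₂ * Y₄ + (Y₁ + t • H)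 * Y₃ * Y₄ + Y₂ * Y₃ * Y₄)) =
      ((6 : ℂ)⁻¹ • (Y₁ ^ 3 + Y₂ ^ 3 + Y₃ ^ 3 + Y₄ ^ 3) + (2 : ℂ)⁻¹ • (Y₁ ^ 2 * Y₂ + Y₁ * Y₂ ^ 2 + Y₁ ^ 2 * Y₃ + Y₁ * Y₃ ^ 2 + Y₁ ^ 2 * Y₄ + Y₁ * Y₄ ^ 2 + Y₂ ^ 2 * Y₃ + Y₂ * Y₃ ^ 2 + Y₂ ^ 2 * Y₄ + Y₂ * Y₄ ^ 2 + Y₃ ^ 2 * Y₄ + Y₃ * Y₄ ^ 2) + (Y₁ * Y₂ * Y₃ + Y₁ * Y₂ * Y₄ + Y₁ * Y₃ * Y₄ + Y₂ * Y₃ * Y₄))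
      + t • ((6 : ℂ)⁻¹ • (H * Y₁ * Y₁ + Y₁ * H * Y₁ + Y₁ * Y₁ * H) + (2 : ℂ)⁻¹ • (H * Y₁ * Y₂ + Y₁ * H * Y₂ + H * (Y₂ * Y₂) + H * Y₁ * Y₃ +
          Y₁ * H * Y₃ + H * (Y₃ * Y₃) + H * Y₁ * Y₄ + Y₁ * H * Y₄ + H * (Y₄ * Y₄)) + (H * Y₂ * Y₃ + H * Y₂ * Y₄ + H * Y₃ * Y₄))
      + t ^ 2 • ((6 : ℂ)⁻¹ • (H * H * Y₁ + H * Y₁ * H + Y₁ * H * H) + (2 : ℂ)⁻¹ • (H * H * Y₂ + H * H * Y₃ + H * H * Y₄))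
      + t ^ 3 • ((6 : ℂ)⁻¹ • (H * H * H)) := by
  simp only [pow_succ, pow_zero, one_mul, add_mul, mul_add, smul_mul_assoc, mul_smul_comm, smul_add, smul_smul, mul_assoc]
  module

/-- The derivative at `0` of a vector cubic `c₀ + t·c₁ + t²·c₂ + t³·c₃` is `c₁`. [folklore] -/
theorem hasDerivAt_cubicPoly_zero {E : Type*} [NormedAddCommGroup E] [NormedSpace ℂ E] (c₀ c₁ c₂ c₃ : E) :
    HasDerivAt (fun t : ℂ => c₀ + t • c₁ + t ^ 2 • c₂ + t ^ 3 • c₃) c₁ 0 := by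
  have h1 : HasDerivAt (fun t : ℂ => t • c₁) ((1 : ℂ) • c₁) 0 := (hasDerivAt_id (0 : ℂ)).smul_const c₁
  have h2 : HasDerivAt (fun t : ℂ => t ^ 2 • c₂) (((2 : ℕ) * (0 : ℂ) ^ 1) • c₂) 0 := (hasDerivAt_pow 2 (0 : ℂ)).smul_const c₂
  have h3 : HasDerivAt (fun t : ℂ => t ^ 3 • c₃) (((3 : ℕ) * (0 : ℂ) ^ 2) • c₃) 0 := (hasDerivAt_pow 3 (0 : ℂ)).smul_const c₃
  have key := ((h1.const_add c₀).add h2).add h3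
  simp only [one_smul, pow_one, mul_zero, zero_smul, add_zero, Nat.cast_ofNat, ne_eq, OfNat.ofNat_ne_zero,
    not_false_eq_true, zero_pow] at key
  exact key

/-- **THE SLOT-ONE TRACE DERIVATIVE OF THE CUBIC TERM**: `d/dt tr C(Y₁ + tH, Y₂, Y₃, Y₄)|₀ = tr(H·∇₁C(Y))` with the slot-one trace-gradient
`∇₁C(Y) = ½Y₁² + ½Σ_{j>1}(Y₁Yⱼ + YⱼY₁ + Yⱼ²) + Y₂Y₃ + Y₂Y₄ + Y₃Y₄` (trace cyclicity moves `H` to the front).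
[cite: Balaban1985Variational, (90)-(93) pp.291-292] -/
theorem hasDerivAt_trace_cubic_slot1 (Y₁ Y₂ Y₃ Y₄ H : Matrix n n ℂ) :
    HasDerivAt (fun t : ℂ => Matrix.trace ((6 : ℂ)⁻¹ • ((Y₁ + t • H) ^ 3 + Y₂ ^ 3 + Y₃ ^ 3 + Y₄ ^ 3) + (2 : ℂ)⁻¹ • ((Y₁ + t • H) ^ 2 * Y₂ + (Y₁ + t • H) * Y₂ ^ 2 + (Y₁ + t • H) ^ 2 * Y₃ + (Y₁ + t • H) * Y₃ ^ 2 + (Y₁ + t • H) ^ 2 * Y₄ + (Y₁ + t • H) * Y₄ ^ 2 + Y₂ ^ 2 * Y₃ + Y₂ * Y₃ ^ 2 + Y₂ ^ 2 * Y₄ + Y₂ * Y₄ ^ 2 + Y₃ ^ 2 * Y₄ + Y₃ * Y₄ ^ 2) + ((Y₁ + t • H) * Y₂ * Y₃ + (Y₁ + t • H) * Y₂ * Y₄ + (Y₁ + t • H) * Y₃ * Y₄ + Y₂ * Y₃ * Y₄)))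
      (Matrix.trace (H * ((2 : ℂ)⁻¹ • Y₁ ^ 2 + (2 : ℂ)⁻¹ • (Y₁ * Y₂ + Y₂ * Y₁ + Y₂ ^ 2 + Y₁ * Y₃ + Y₃ * Y₁ + Y₃ ^ 2 + Y₁ * Y₄ + Y₄ * Y₁ + Y₄ ^ 2) + (Y₂ * Y₃ + Y₂ * Y₄ + Y₃ * Y₄)))) 0 := by
  have hexp := hasDerivAt_cubicPoly_zero
    ((6 : ℂ)⁻¹ • (Y₁ ^ 3 + Y₂ ^ 3 + Y₃ ^ 3 + Y₄ ^ 3) + (2 : ℂ)⁻¹ • (Y₁ ^ 2 * Y₂ + Y₁ * Y₂ ^ 2 + Y₁ ^ 2 * Y₃ + Y₁ * Y₃ ^ 2 + Y₁ ^ 2 * Y₄ + Y₁ * Y₄ ^ 2 + Y₂ ^ 2 * Y₃ + Y₂ * Y₃ ^ 2 + Y₂ ^ 2 * Y₄ + Y₂ * Y₄ ^ 2 + Y₃ ^ 2 * Y₄ + Y₃ * Y₄ ^ 2) + (Y₁ * Y₂ * Y₃ + Y₁ * Y₂ * Y₄ + Y₁ * Y₃ * Y₄ + Y₂ * Y₃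 * Y₄))
    ((6 : ℂ)⁻¹ • (H * Y₁ * Y₁ + Y₁ * H * Y₁ + Y₁ * Y₁ * H) + (2 : ℂ)⁻¹ • (H * Y₁ * Y₂ + Y₁ * H * Y₂ + H * (Y₂ * Y₂) + H * Y₁ * Y₃ +
          Y₁ * H * Y₃ + H * (Y₃ * Y₃) + H * Y₁ * Y₄ + Y₁ * H * Y₄ + H * (Y₄ * Y₄)) + (H * Y₂ * Y₃ + H * Y₂ * Y₄ + H * Y₃ * Y₄))
    ((6 : ℂ)⁻¹ • (H * H * Y₁ + H * Y₁ * H + Y₁ * H * H) + (2 : ℂ)⁻¹ • (H * H * Y₂ + H * H * Y₃ + H * H * Y₄))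
    ((6 : ℂ)⁻¹ • (H * H * H))
  have hfun : (fun t : ℂ => Matrix.trace ((6 : ℂ)⁻¹ • ((Y₁ + t • H) ^ 3 + Y₂ ^ 3 + Y₃ ^ 3 + Y₄ ^ 3) + (2 : ℂ)⁻¹ • ((Y₁ + t • H) ^ 2 * Y₂ + (Y₁ + t • H) * Y₂ ^ 2 + (Y₁ + t • H) ^ 2 * Y₃ + (Y₁ + t • H) * Y₃ ^ 2 + (Y₁ + t • H) ^ 2 * Y₄ + (Y₁ + t • H) * Y₄ ^ 2 + Y₂ ^ 2 * Y₃ + Y₂ * Y₃ ^ 2 + Y₂ ^ 2 * Y₄ + Y₂ * Y₄ ^ 2 + Y₃ ^ 2 * Y₄ + Y₃ * Y₄ ^ 2) + ((Y₁ + t • H) * Y₂ * Y₃ + (Y₁ + t • H) * Y₂ * Y₄ + (Y₁ + t • H) * Y₃ * Y₄ + Y₂ * Y₃ * Y₄))) =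
      fun t : ℂ => Matrix.trace (((6 : ℂ)⁻¹ • (Y₁ ^ 3 + Y₂ ^ 3 + Y₃ ^ 3 + Y₄ ^ 3) + (2 : ℂ)⁻¹ • (Y₁ ^ 2 * Y₂ + Y₁ * Y₂ ^ 2 + Y₁ ^ 2 * Y₃ + Y₁ * Y₃ ^ 2 + Y₁ ^ 2 * Y₄ + Y₁ * Y₄ ^ 2 + Y₂ ^ 2 * Y₃ + Y₂ * Y₃ ^ 2 + Y₂ ^ 2 * Y₄ + Y₂ * Y₄ ^ 2 + Y₃ ^ 2 * Y₄ + Y₃ * Y₄ ^ 2) + (Y₁ * Y₂ * Y₃ + Y₁ * Y₂ * Y₄ + Y₁ * Y₃ * Y₄ + Y₂ * Y₃ * Y₄))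
      + t • ((6 : ℂ)⁻¹ • (H * Y₁ * Y₁ + Y₁ * H * Y₁ + Y₁ * Y₁ * H) + (2 : ℂ)⁻¹ • (H * Y₁ * Y₂ + Y₁ * H * Y₂ + H * (Y₂ * Y₂) + H * Y₁ * Y₃ +
          Y₁ * H * Y₃ + H * (Y₃ * Y₃) + H * Y₁ * Y₄ + Y₁ * H * Y₄ + H * (Y₄ * Y₄)) + (H * Y₂ * Y₃ + H * Y₂ * Y₄ + H * Y₃ * Y₄))
      + t ^ 2 • ((6 : ℂ)⁻¹ • (H * H * Y₁ + H * Y₁ * H + Y₁ * H * H) + (2 : ℂ)⁻¹ • (H * H * Y₂ + H * H * Y₃ + H * H * Y₄))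
      + t ^ 3 • ((6 : ℂ)⁻¹ • (H * H * H))) := by
    funext t; rw [cubic_slot1_expand]
  rw [hfun]
  have htr := (LinearMap.toContinuousLinearMap (Matrix.traceLinearMap n ℂ ℂ)).hasFDerivAt.comp_hasDerivAt (0 : ℂ) hexp
  -- the derivative's trace, with `H` cycled to the front
  have c1 : Matrix.trace (Y₁ * H * Y₁) = Matrix.trace (H * Y₁ * Y₁) := by rw [mul_assoc, Matrix.trace_mul_comm]
  have c2 : Matrix.trace (Y₁ * Y₁ * H) = Matrix.trace (H * Y₁ * Y₁) := by rw [Matrix.trace_mul_comm, ← mul_assoc]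
  have c3 : Matrix.trace (Y₁ * H * Y₂) = Matrix.trace (H * Y₂ * Y₁) := by rw [mul_assoc, Matrix.trace_mul_comm]
  have c4 : Matrix.trace (Y₁ * H * Y₃) = Matrix.trace (H * Y₃ * Y₁) := by rw [mul_assoc, Matrix.trace_mul_comm]
  have c5 : Matrix.trace (Y₁ * H * Y₄) = Matrix.trace (H * Y₄ * Y₁) := by rw [mul_assoc, Matrix.trace_mul_comm]
  refine htr.congr_deriv ?_
  simp only [LinearMap.coe_toContinuousLinearMap', Matrix.traceLinearMap_apply, pow_two, mul_add, smul_add,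
    mul_smul_comm, Matrix.trace_add, Matrix.trace_smul, smul_eq_mul, ← mul_assoc]
  rw [c1, c2, c3, c4, c5]
  ring

/-- **CYCLIC INVARIANCE OF THE TRACED CUBIC TERM**: `tr C(Y₂, Y₃, Y₄, Y₁) = tr C(Y₁, Y₂, Y₃, Y₄)` — the cubic Taylor term of `tr(e^{Y₁}e^{Y₂}e^{Y₃}e^{Y₄})`
is that of `tr(e^{Y₂}e^{Y₃}e^{Y₄}e^{Y₁})`, so every slot-gradient of `tr C` is a slot-ONE gradient of a rotation. [folklore] -/
theorem trace_cubic_rotate (Y₁ Y₂ Y₃ Y₄ : Matrix n n ℂ) :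
    Matrix.trace ((6 : ℂ)⁻¹ • (Y₂ ^ 3 + Y₃ ^ 3 + Y₄ ^ 3 + Y₁ ^ 3) + (2 : ℂ)⁻¹ • (Y₂ ^ 2 * Y₃ + Y₂ * Y₃ ^ 2 + Y₂ ^ 2 * Y₄ + Y₂ * Y₄ ^ 2 + Y₂ ^ 2 * Y₁ + Y₂ * Y₁ ^ 2 + Y₃ ^ 2 * Y₄ + Y₃ * Y₄ ^ 2 + Y₃ ^ 2 * Y₁ + Y₃ * Y₁ ^ 2 + Y₄ ^ 2 * Y₁ + Y₄ * Y₁ ^ 2) + (Y₂ * Y₃ * Y₄ + Y₂ * Y₃ * Y₁ + Y₂ * Y₄ * Y₁ + Y₃ * Y₄ * Y₁)) = Matrix.trace ((6 : ℂ)⁻¹ • (Y₁ ^ 3 + Y₂ ^ 3 + Y₃ ^ 3 + Y₄ ^ 3) + (2 : ℂ)⁻¹ • (Y₁ ^ 2 * Y₂ + Y₁ * Y₂ ^ 2 + Y₁ ^ 2 * Y₃ + Y₁ * Y₃ ^ 2 + Y₁ ^ 2 * Y₄ + Y₁ * Y₄ ^ 2 + Y₂ ^ 2 * Y₃ + Y₂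 * Y₃ ^ 2 + Y₂ ^ 2 * Y₄ + Y₂ * Y₄ ^ 2 + Y₃ ^ 2 * Y₄ + Y₃ * Y₄ ^ 2) + (Y₁ * Y₂ * Y₃ + Y₁ * Y₂ * Y₄ + Y₁ * Y₃ * Y₄ + Y₂ * Y₃ * Y₄)) := by
  have p1 : Matrix.trace (Y₂ ^ 2 * Y₁) = Matrix.trace (Y₁ * Y₂ ^ 2) := Matrix.trace_mul_comm _ _
  have p2 : Matrix.trace (Y₂ * Y₁ ^ 2) = Matrix.trace (Y₁ ^ 2 * Y₂) := Matrix.trace_mul_comm _ _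
  have p3 : Matrix.trace (Y₃ ^ 2 * Y₁) = Matrix.trace (Y₁ * Y₃ ^ 2) := Matrix.trace_mul_comm _ _
  have p4 : Matrix.trace (Y₃ * Y₁ ^ 2) = Matrix.trace (Y₁ ^ 2 * Y₃) := Matrix.trace_mul_comm _ _
  have p5 : Matrix.trace (Y₄ ^ 2 * Y₁) = Matrix.trace (Y₁ * Y₄ ^ 2) := Matrix.trace_mul_comm _ _
  have p6 : Matrix.trace (Y₄ * Y₁ ^ 2) = Matrix.trace (Y₁ ^ 2 * Y₄) := Matrix.trace_mul_comm _ _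
  have t1 : Matrix.trace (Y₂ * Y₃ * Y₁) = Matrix.trace (Y₁ * Y₂ * Y₃) := Matrix.trace_mul_cycle _ _ _
  have t2 : Matrix.trace (Y₂ * Y₄ * Y₁) = Matrix.trace (Y₁ * Y₂ * Y₄) := Matrix.trace_mul_cycle _ _ _
  have t3 : Matrix.trace (Y₃ * Y₄ * Y₁) = Matrix.trace (Y₁ * Y₃ * Y₄) := Matrix.trace_mul_cycle _ _ _
  simp only [Matrix.trace_add, Matrix.trace_smul, smul_eq_mul]
  linear_combination (2 : ℂ)⁻¹ * (p1 + p2 + p3 + p4 + p5 + p6) + (t1 + t2 + t3)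

/-- **THE LEIBNIZ IDENTITY OF THE CUBIC TERM** (the mechanism of (93)–(96)): the slot-one gradient at `Y` minus the slot-one gradient at the
half-turn `(Y₃, Y₄, Y₁, Y₂)` (= the slot-three gradient at `Y`) is a combination of COMMUTATORS WITH THE SUMS `S = Y₁ + Y₃`, `T = Y₂ + Y₄`:
`2(∇₁C(Y₁,Y₂,Y₃,Y₄) − ∇₁C(Y₃,Y₄,Y₁,Y₂)) = 2[Y₂, S + T] + [S, T]`.  On a lattice plaquette `S`, `T` are `±iη` times bond DIFFERENCES of the gauge
field, so the two gradients through which one bond enters the two plaquettes of a plane containing it cancel to first order.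
[cite: Balaban1985Variational, (93)-(96) p.292] -/
theorem two_smul_grad1_sub_grad1_rotate2 (Y₁ Y₂ Y₃ Y₄ : Matrix n n ℂ) :
    (2 : ℂ) • (((2 : ℂ)⁻¹ • Y₁ ^ 2 + (2 : ℂ)⁻¹ • (Y₁ * Y₂ + Y₂ * Y₁ + Y₂ ^ 2 + Y₁ * Y₃ + Y₃ * Y₁ + Y₃ ^ 2 + Y₁ * Y₄ + Y₄ * Y₁ + Y₄ ^ 2) + (Y₂ * Y₃ + Y₂ * Y₄ + Y₃ * Y₄)) - ((2 : ℂ)⁻¹ • Y₃ ^ 2 + (2 : ℂ)⁻¹ • (Y₃ * Y₄ + Y₄ * Y₃ + Y₄ ^ 2 + Y₃ * Y₁ + Y₁ * Y₃ + Y₁ ^ 2 + Y₃ * Y₂ + Y₂ * Y₃ + Y₂ ^ 2) + (Y₄ * Y₁ + Y₄ * Y₂ + Y₁ * Y₂))) =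
      2 * (Y₂ * ((Y₁ + Y₃) + (Y₂ + Y₄)) - ((Y₁ + Y₃) + (Y₂ + Y₄)) * Y₂) + ((Y₁ + Y₃) * (Y₂ + Y₄) - (Y₂ + Y₄) * (Y₁ + Y₃)) := by
  simp only [smul_sub, smul_add, smul_smul]
  rw [show (2 : ℂ) * (2 : ℂ)⁻¹ = 1 by norm_num, show (2 : ℂ) = ((2 : ℕ) : ℂ) by norm_num]
  simp only [Nat.cast_smul_eq_nsmul, one_smul]
  noncomm_ring

omit [DecidableEq n] in
/-- `‖AB − A′B′‖ ≤ ‖A − A′‖·m + m·‖B − B′‖` when `‖B‖, ‖A′‖ ≤ m`. [folklore] -/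
theorem norm_mul_sub_mul_le' [DecidableEq n] {A A' B B' : Matrix n n ℂ} {m : ℝ} (hB : ‖B‖ ≤ m) (hA' : ‖A'‖ ≤ m) :
    ‖A * B - A' * B'‖ ≤ ‖A - A'‖ * m + m * ‖B - B'‖ := by
  have e : A * B - A' * B' = (A - A') * B + A' * (B - B') := by noncomm_ring
  rw [e]
  exact (norm_add_le _ _).trans (add_le_add ((norm_mul_le _ _).trans (mul_le_mul_of_nonneg_left hB (norm_nonneg _)))
    ((norm_mul_le _ _).trans (mul_le_mul_of_nonneg_right hA' (norm_nonneg _))))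

/-- **LIPSCHITZ BOUND OF THE SLOT-ONE GRADIENT**: for `‖Yᵢ‖, ‖Yᵢ′‖ ≤ m` and `‖Yᵢ − Yᵢ′‖ ≤ Δ`, `‖∇₁C(Y) − ∇₁C(Y′)‖ ≤ 16·m·Δ` (eight monomial weights,
each monomial moving by `≤ 2mΔ`). [folklore] -/
theorem norm_grad1_sub_grad1_le {Y₁ Y₂ Y₃ Y₄ Z₁ Z₂ Z₃ Z₄ : Matrix n n ℂ} {m Δ : ℝ} (hm : 0 ≤ m)
    (h1 : ‖Y₁‖ ≤ m) (h2 : ‖Y₂‖ ≤ m) (h3 : ‖Y₃‖ ≤ m) (h4 : ‖Y₄‖ ≤ m)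
    (g1 : ‖Z₁‖ ≤ m) (g2 : ‖Z₂‖ ≤ m) (g3 : ‖Z₃‖ ≤ m) (g4 : ‖Z₄‖ ≤ m)
    (d1 : ‖Y₁ - Z₁‖ ≤ Δ) (d2 : ‖Y₂ - Z₂‖ ≤ Δ) (d3 : ‖Y₃ - Z₃‖ ≤ Δ) (d4 : ‖Y₄ - Z₄‖ ≤ Δ) :
    ‖((2 : ℂ)⁻¹ • Y₁ ^ 2 + (2 : ℂ)⁻¹ • (Y₁ * Y₂ + Y₂ * Y₁ + Y₂ ^ 2 + Y₁ * Y₃ + Y₃ * Y₁ + Y₃ ^ 2 + Y₁ * Y₄ + Y₄ * Y₁ + Y₄ ^ 2) + (Y₂ * Y₃ + Y₂ * Y₄ + Y₃ * Y₄)) - ((2 : ℂ)⁻¹ • Z₁ ^ 2 + (2 : ℂ)⁻¹ • (Z₁ * Z₂ + Z₂ * Z₁ + Z₂ ^ 2 + Z₁ * Z₃ + Z₃ * Z₁ + Z₃ ^ 2 + Z₁ * Z₄ + Z₄ * Z₁ + Z₄ ^ 2) + (Z₂ * Z₃ + Z₂ * Z₄ + Z₃ * Z₄))‖ ≤ 16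 * m * Δ := by
  have hΔ : 0 ≤ Δ := (norm_nonneg _).trans d1
  -- every monomial difference is at most `2mΔ`
  have M : ∀ {A A' B B' : Matrix n n ℂ}, ‖A‖ ≤ m → ‖B‖ ≤ m → ‖A'‖ ≤ m → ‖B'‖ ≤ m → ‖A - A'‖ ≤ Δ → ‖B - B'‖ ≤ Δ →
      ‖A * B - A' * B'‖ ≤ 2 * m * Δ := by
    intro A A' B B' hA hB hA' hB' dA dB
    calc ‖A * B - A' * B'‖ ≤ ‖A - A'‖ * m + m * ‖B - B'‖ := norm_mul_sub_mul_le' hB hA'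
      _ ≤ Δ * m + m * Δ := add_le_add (mul_le_mul_of_nonneg_right dA hm) (mul_le_mul_of_nonneg_left dB hm)
      _ = 2 * m * Δ := by ring
  have e : ((2 : ℂ)⁻¹ • Y₁ ^ 2 + (2 : ℂ)⁻¹ • (Y₁ * Y₂ + Y₂ * Y₁ + Y₂ ^ 2 + Y₁ * Y₃ + Y₃ * Y₁ + Y₃ ^ 2 + Y₁ * Y₄ + Y₄ * Y₁ + Y₄ ^ 2) + (Y₂ * Y₃ + Y₂ * Y₄ + Y₃ * Y₄)) - ((2 : ℂ)⁻¹ • Z₁ ^ 2 + (2 : ℂ)⁻¹ • (Z₁ * Z₂ + Z₂ * Z₁ + Z₂ ^ 2 + Z₁ * Z₃ + Z₃ * Z₁ + Z₃ ^ 2 + Z₁ * Z₄ + Z₄ * Z₁ + Z₄ ^ 2) + (Z₂ * Z₃ + Z₂ * Z₄ + Z₃ * Z₄)) =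
      (2 : ℂ)⁻¹ • (Y₁ * Y₁ - Z₁ * Z₁) + (2 : ℂ)⁻¹ • ((Y₁ * Y₂ - Z₁ * Z₂) + (Y₂ * Y₁ - Z₂ * Z₁) + (Y₂ * Y₂ - Z₂ * Z₂) + (Y₁ * Y₃ - Z₁ * Z₃)
        + (Y₃ * Y₁ - Z₃ * Z₁) + (Y₃ * Y₃ - Z₃ * Z₃) + (Y₁ * Y₄ - Z₁ * Z₄) + (Y₄ * Y₁ - Z₄ * Z₁) + (Y₄ * Y₄ - Z₄ * Z₄))
        + ((Y₂ * Y₃ - Z₂ * Z₃) + (Y₂ * Y₄ - Z₂ * Z₄) + (Y₃ * Y₄ - Z₃ * Z₄)) := by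
    simp only [pow_two, smul_add, smul_sub]; abel
  rw [e]
  have n2 : ‖(2 : ℂ)⁻¹‖ = 2⁻¹ := by rw [norm_inv, Complex.norm_ofNat]
  have b1 := M h1 h1 g1 g1 d1 d1
  have b12 := M h1 h2 g1 g2 d1 d2
  have b21 := M h2 h1 g2 g1 d2 d1
  have b22 := M h2 h2 g2 g2 d2 d2
  have b13 := M h1 h3 g1 g3 d1 d3
  have b31 := M h3 h1 g3 g1 d3 d1
  have b33 := M h3 h3 g3 g3 d3 d3
  have b14 := M h1 h4 g1 g4 d1 d4
  have b41 := M h4 h1 g4 g1 d4 d1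
  have b44 := M h4 h4 g4 g4 d4 d4
  have b23 := M h2 h3 g2 g3 d2 d3
  have b24 := M h2 h4 g2 g4 d2 d4
  have b34 := M h3 h4 g3 g4 d3 d4
  have s9 : ‖(Y₁ * Y₂ - Z₁ * Z₂) + (Y₂ * Y₁ - Z₂ * Z₁) + (Y₂ * Y₂ - Z₂ * Z₂) + (Y₁ * Y₃ - Z₁ * Z₃)
        + (Y₃ * Y₁ - Z₃ * Z₁) + (Y₃ * Y₃ - Z₃ * Z₃) + (Y₁ * Y₄ - Z₁ * Z₄) + (Y₄ * Y₁ - Z₄ * Z₁) + (Y₄ * Y₄ - Z₄ * Z₄)‖ ≤ 9 * (2 * m * Δ) :=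
    ((norm_add_le _ _).trans (add_le_add ((norm_add_le _ _).trans (add_le_add ((norm_add_le _ _).trans (add_le_add
      ((norm_add_le _ _).trans (add_le_add ((norm_add_le _ _).trans (add_le_add ((norm_add_le _ _).trans (add_le_add
      ((norm_add_le _ _).trans (add_le_add ((norm_add_le _ _).trans (add_le_add b12 b21)) b22)) b13)) b31)) b33)) b14)) b41)) b44)).trans
      (by linarith)
  have s3 : ‖(Y₂ * Y₃ - Z₂ * Z₃) + (Y₂ * Y₄ - Z₂ * Z₄) + (Y₃ * Y₄ - Z₃ * Z₄)‖ ≤ 3 * (2 * m * Δ) :=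
    ((norm_add_le _ _).trans (add_le_add ((norm_add_le _ _).trans (add_le_add b23 b24)) b34)).trans (by linarith)
  calc _ ≤ ‖(2 : ℂ)⁻¹ • (Y₁ * Y₁ - Z₁ * Z₁)‖ + ‖(2 : ℂ)⁻¹ • ((Y₁ * Y₂ - Z₁ * Z₂) + (Y₂ * Y₁ - Z₂ * Z₁) + (Y₂ * Y₂ - Z₂ * Z₂) + (Y₁ * Y₃ - Z₁ * Z₃)
        + (Y₃ * Y₁ - Z₃ * Z₁) + (Y₃ * Y₃ - Z₃ * Z₃) + (Y₁ * Y₄ - Z₁ * Z₄) + (Y₄ * Y₁ - Z₄ * Z₁) + (Y₄ * Y₄ - Z₄ * Z₄))‖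
        + ‖(Y₂ * Y₃ - Z₂ * Z₃) + (Y₂ * Y₄ - Z₂ * Z₄) + (Y₃ * Y₄ - Z₃ * Z₄)‖ :=
          (norm_add_le _ _).trans (add_le_add (norm_add_le _ _) le_rfl)
    _ ≤ 2⁻¹ * (2 * m * Δ) + 2⁻¹ * (9 * (2 * m * Δ)) + 3 * (2 * m * Δ) := by
          rw [norm_smul, norm_smul, n2]
          exact add_le_add (add_le_add (mul_le_mul_of_nonneg_left b1 (by norm_num)) (mul_le_mul_of_nonneg_left s9 (by norm_num))) s3
    _ = 16 * m * Δ := by ring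

/-- **THE SMALL-FACTOR BOUND**: `‖2[Y₂, S+T] + [S,T]‖ ≤ 4m(‖S‖ + ‖T‖) + 2‖S‖‖T‖` for `‖Y₂‖ ≤ m`. [folklore] -/
theorem norm_comm_combo_le {Y₂ S T : Matrix n n ℂ} {m : ℝ} (h2 : ‖Y₂‖ ≤ m) :
    ‖2 * (Y₂ * (S + T) - (S + T) * Y₂) + (S * T - T * S)‖ ≤ 4 * m * (‖S‖ + ‖T‖) + 2 * (‖S‖ * ‖T‖) := by
  have hm : 0 ≤ m := (norm_nonneg _).trans h2
  have hST : ‖S + T‖ ≤ ‖S‖ + ‖T‖ := norm_add_le _ _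
  have a1 : ‖Y₂ * (S + T) - (S + T) * Y₂‖ ≤ m * (‖S‖ + ‖T‖) + (‖S‖ + ‖T‖) * m :=
    (norm_sub_le _ _).trans (add_le_add ((norm_mul_le _ _).trans (mul_le_mul h2 hST (norm_nonneg _) hm))
      ((norm_mul_le _ _).trans (mul_le_mul hST h2 (norm_nonneg _) ((norm_nonneg _).trans hST))))
  have a2 : ‖S * T - T * S‖ ≤ ‖S‖ * ‖T‖ + ‖T‖ * ‖S‖ :=
    (norm_sub_le _ _).trans (add_le_add (norm_mul_le _ _) (norm_mul_le _ _))
  have a3 : ‖(2 : Matrix n n ℂ) * (Y₂ * (S + T) - (S + T) * Y₂)‖ ≤ 2 * (m * (‖S‖ + ‖T‖) + (‖S‖ + ‖T‖) * m) := by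
    rw [two_mul]
    exact (norm_add_le _ _).trans (by linarith)
  calc _ ≤ ‖(2 : Matrix n n ℂ) * (Y₂ * (S + T) - (S + T) * Y₂)‖ + ‖S * T - T * S‖ := norm_add_le _ _
    _ ≤ 2 * (m * (‖S‖ + ‖T‖) + (‖S‖ + ‖T‖) * m) + (‖S‖ * ‖T‖ + ‖T‖ * ‖S‖) := add_le_add a3 a2
    _ = 4 * m * (‖S‖ + ‖T‖) + 2 * (‖S‖ * ‖T‖) := by ring

/-- **THE CANCELLATION ESTIMATE** assembled: for `‖Yᵢ‖, ‖Zᵢ‖ ≤ m`, slotwise `‖Yᵢ − Zᵢ‖ ≤ Δ`, and `‖Y₁ + Y₃‖, ‖Y₂ + Y₄‖ ≤ δ`,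
`‖∇₁C(Y₁,Y₂,Y₃,Y₄) − ∇₁C(Z₃,Z₄,Z₁,Z₂)‖ ≤ 16mΔ + 4mδ + δ²` (Lipschitz to the half-turn of `Z`, then the Leibniz identity at `Y`).
[cite: Balaban1985Variational, (93)-(96) p.292] -/
theorem norm_grad1_sub_grad1_halfturn_le {Y₁ Y₂ Y₃ Y₄ Z₁ Z₂ Z₃ Z₄ : Matrix n n ℂ} {m Δ δ : ℝ} (hm : 0 ≤ m)
    (h1 : ‖Y₁‖ ≤ m) (h2 : ‖Y₂‖ ≤ m) (h3 : ‖Y₃‖ ≤ m) (h4 : ‖Y₄‖ ≤ m)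
    (g1 : ‖Z₁‖ ≤ m) (g2 : ‖Z₂‖ ≤ m) (g3 : ‖Z₃‖ ≤ m) (g4 : ‖Z₄‖ ≤ m)
    (d1 : ‖Y₁ - Z₁‖ ≤ Δ) (d2 : ‖Y₂ - Z₂‖ ≤ Δ) (d3 : ‖Y₃ - Z₃‖ ≤ Δ) (d4 : ‖Y₄ - Z₄‖ ≤ Δ)
    (hS : ‖Y₁ + Y₃‖ ≤ δ) (hT : ‖Y₂ + Y₄‖ ≤ δ) :
    ‖((2 : ℂ)⁻¹ • Y₁ ^ 2 + (2 : ℂ)⁻¹ • (Y₁ * Y₂ + Y₂ * Y₁ + Y₂ ^ 2 + Y₁ * Y₃ + Y₃ * Y₁ + Y₃ ^ 2 + Y₁ * Y₄ + Y₄ * Y₁ + Y₄ ^ 2) + (Y₂ * Y₃ + Y₂ * Y₄ + Y₃ * Y₄)) - ((2 : ℂ)⁻¹ • Z₃ ^ 2 + (2 : ℂ)⁻¹ • (Z₃ * Z₄ + Z₄ * Z₃ + Z₄ ^ 2 + Z₃ * Z₁ + Z₁ * Z₃ + Z₁ ^ 2 + Z₃ * Z₂ + Z₂ * Z₃ + Z₂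 ^ 2) + (Z₄ * Z₁ + Z₄ * Z₂ + Z₁ * Z₂))‖ ≤ 16 * m * Δ + 4 * m * δ + δ ^ 2 := by
  have hδ : 0 ≤ δ := (norm_nonneg _).trans hS
  -- Lipschitz: half-turn of `Y` to half-turn of `Z`
  have hL := norm_grad1_sub_grad1_le (Y₁ := Y₃) (Y₂ := Y₄) (Y₃ := Y₁) (Y₄ := Y₂) (Z₁ := Z₃) (Z₂ := Z₄) (Z₃ := Z₁) (Z₄ := Z₂)
    hm h3 h4 h1 h2 g3 g4 g1 g2 d3 d4 d1 d2
  -- Leibniz at `Y`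
  have hI := two_smul_grad1_sub_grad1_rotate2 Y₁ Y₂ Y₃ Y₄
  have hC := norm_comm_combo_le (S := Y₁ + Y₃) (T := Y₂ + Y₄) h2
  rw [← hI, norm_smul, Complex.norm_ofNat] at hC
  have hC' : ‖((2 : ℂ)⁻¹ • Y₁ ^ 2 + (2 : ℂ)⁻¹ • (Y₁ * Y₂ + Y₂ * Y₁ + Y₂ ^ 2 + Y₁ * Y₃ + Y₃ * Y₁ + Y₃ ^ 2 + Y₁ * Y₄ + Y₄ * Y₁ + Y₄ ^ 2) + (Y₂ * Y₃ + Y₂ * Y₄ + Y₃ * Y₄)) - ((2 : ℂ)⁻¹ • Y₃ ^ 2 + (2 : ℂ)⁻¹ • (Y₃ * Y₄ + Y₄ * Y₃ + Y₄ ^ 2 + Y₃ * Y₁ + Y₁ * Y₃ + Y₁ ^ 2 + Y₃ * Y₂ + Y₂ * Y₃ + Y₂ ^ 2) + (Y₄ * Y₁ + Y₄ * Y₂ + Y₁ * Y₂))‖ ≤ 4 * m * δ + δ ^ 2 := by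
    have hprod : ‖Y₁ + Y₃‖ * ‖Y₂ + Y₄‖ ≤ δ * δ := mul_le_mul hS hT (norm_nonneg _) hδ
    nlinarith [hC, hprod, norm_nonneg (Y₁ + Y₃), norm_nonneg (Y₂ + Y₄)]
  calc _ = ‖(((2 : ℂ)⁻¹ • Y₁ ^ 2 + (2 : ℂ)⁻¹ • (Y₁ * Y₂ + Y₂ * Y₁ + Y₂ ^ 2 + Y₁ * Y₃ + Y₃ * Y₁ + Y₃ ^ 2 + Y₁ * Y₄ + Y₄ * Y₁ + Y₄ ^ 2) + (Y₂ * Y₃ + Y₂ * Y₄ + Y₃ * Y₄)) - ((2 : ℂ)⁻¹ • Y₃ ^ 2 + (2 : ℂ)⁻¹ • (Y₃ * Y₄ + Y₄ * Y₃ + Y₄ ^ 2 + Y₃ * Y₁ + Y₁ * Y₃ + Y₁ ^ 2 + Y₃ * Y₂ + Y₂ * Y₃ + Y₂ ^ 2) + (Y₄ * Y₁ + Y₄ * Y₂ + Y₁ * Y₂)))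
        + (((2 : ℂ)⁻¹ • Y₃ ^ 2 + (2 : ℂ)⁻¹ • (Y₃ * Y₄ + Y₄ * Y₃ + Y₄ ^ 2 + Y₃ * Y₁ + Y₁ * Y₃ + Y₁ ^ 2 + Y₃ * Y₂ + Y₂ * Y₃ + Y₂ ^ 2) + (Y₄ * Y₁ + Y₄ * Y₂ + Y₁ * Y₂)) - ((2 : ℂ)⁻¹ • Z₃ ^ 2 + (2 : ℂ)⁻¹ • (Z₃ * Z₄ + Z₄ * Z₃ + Z₄ ^ 2 + Z₃ * Z₁ + Z₁ * Z₃ + Z₁ ^ 2 + Z₃ * Z₂ + Z₂ * Z₃ + Z₂ ^ 2) + (Z₄ * Z₁ + Z₄ * Z₂ + Z₁ * Z₂)))‖ := by rw [sub_add_sub_cancel]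
    _ ≤ (4 * m * δ + δ ^ 2) + 16 * m * Δ := (norm_add_le _ _).trans (add_le_add hC' hL)
    _ = 16 * m * Δ + 4 * m * δ + δ ^ 2 := by ring

end Cubic

end Summit.QuantumFields.YangMills.Theorems.FlatPlaqCubic

end
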